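import Summits.AtomisticToContinuum.Crystallization.Theorems.FrustratedLawDichotomyAveragingCut

/-!
# FrustratedLawDichotomy · AVERAGING CUT, part B (§3 admissible instances: bounded finite-range pair potentials, crude floors, the surplus floor)

Continuation of `FrustratedLawDichotomyAveragingCut` (lens-5 g35 sha256 90945e53d8094482, 650 l; PRE-SPLIT by hand-2 g12 for the 400-line rule —
bodies byte-identical, same namespace; see the module docstring of part A for the node).  `--supports stmt-AtomisticToContinuum-27623 --as helper`.
-/

noncomputable section

namespace Summit.AtomisticToContinuum.Crystallization.Theorems.FrustratedLawDichotomyAveragingCut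


open scoped BigOperators Classical
open Literature.MathematicalPhysics.StatisticalMechanics (interactionEnergy lennardJones siteEnergy two_mul_interactionEnergy
  neg_one_div_le_lennardJones card_le_of_separated_of_dist_le)
open Summit.AtomisticToContinuum.Crystallization.Theorems.FrustratedLawDichotomyRangeCut
open Summit.AtomisticToContinuum.Crystallization.Theorems.FrustratedLawDichotomySchurCut


/-! ## §3. Admissible instances: bounded finite-range pair potentials, crude floors, the surplus floor -/

/-- **An ADMISSIBLE INSTANCE** of the cut: the pair potential `W` is `≥ −B` on `[0,∞)` and vanishes beyond the range `R`
(a plain `Prop`-valued record of four facts; both literal potentials of the column satisfy it, §5). -/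
structure CutBounds (W : ℝ → ℝ) (R B : ℝ) : Prop where
  range_nonneg : 0 ≤ R
  floor_nonneg : 0 ≤ B
  floor : ∀ r : ℝ, 0 ≤ r → -B ≤ W r
  vanish : ∀ r : ℝ, R < r → W r = 0

/-- `smoothstep₁` takes values in `[0,1]`. [folklore] -/
theorem smoothstep₁_mem {x : ℝ} : 0 ≤ smoothstep₁ x ∧ smoothstep₁ x ≤ 1 := by
  unfold smoothstep₁
  split_ifs with h0 h1
  · exact ⟨le_rfl, zero_le_one⟩
  · exact ⟨zero_le_one, le_rfl⟩
  · push Not at h0 h1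
    constructor
    · have : 3 * x ^ 2 - 2 * x ^ 3 = x ^ 2 * (3 - 2 * x) := by ring
      rw [this]; exact mul_nonneg (by positivity) (by linarith)
    · have h1x : 0 ≤ (1 - x) ^ 2 * (1 + 2 * x) := mul_nonneg (sq_nonneg _) (by linarith)
      have : 1 - (3 * x ^ 2 - 2 * x ^ 3) = (1 - x) ^ 2 * (1 + 2 * x) := by ring
      linarith [this ▸ h1x]

/-- `smoothstep₂` takes values in `[0,1]`. [folklore] -/
theorem smoothstep₂_mem {x : ℝ} : 0 ≤ smoothstep₂ x ∧ smoothstep₂ x ≤ 1 := by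
  unfold smoothstep₂
  split_ifs with h0 h1
  · exact ⟨le_rfl, zero_le_one⟩
  · exact ⟨zero_le_one, le_rfl⟩
  · push Not at h0 h1
    have hx3 : 0 ≤ x ^ 3 := by positivity
    have hq : 0 ≤ 6 * x ^ 2 - 15 * x + 10 := by nlinarith [sq_nonneg (x - 5 / 4)]
    have h1x : 0 ≤ (1 - x) ^ 3 := pow_nonneg (by linarith) 3
    have hq' : 0 ≤ 6 * x ^ 2 + 3 * x + 1 := by nlinarith [sq_nonneg x]
    constructor
    · have : 10 * x ^ 3 - 15 * x ^ 4 + 6 * x ^ 5 = x ^ 3 * (6 * x ^ 2 - 15 * x + 10) := by ring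
      rw [this]; exact mul_nonneg hx3 hq
    · have : 1 - (10 * x ^ 3 - 15 * x ^ 4 + 6 * x ^ 5) = (1 - x) ^ 3 * (6 * x ^ 2 + 3 * x + 1) := by ring
      nlinarith [mul_nonneg h1x hq']

/-- Crude ceiling `ω₂ ≤ 52` on `[0,∞)` (drop the negative monomials, bound `x^k ≤ 2^k` on `[0,2)`). [folklore] -/
theorem omega₂_le {x : ℝ} (hx : 0 ≤ x) : omega₂ x ≤ 52 := by
  unfold omega₂
  split_ifs with h2
  · have hx2 : x ≤ 2 := h2.le
    have h4 : x ^ 4 ≤ 2 ^ 4 := pow_le_pow_left₀ hx hx2 4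
    have h7 : x ^ 7 ≤ 2 ^ 7 := pow_le_pow_left₀ hx hx2 7
    have h11 : x ^ 11 ≤ 2 ^ 11 := pow_le_pow_left₀ hx hx2 11
    have h2' : 0 ≤ x ^ 2 := by positivity
    have h5 : 0 ≤ x ^ 5 := by positivity
    have h9 : 0 ≤ x ^ 9 := by positivity
    nlinarith
  · norm_num

/-- **Generic crude floor of a Schur-cut potential**: `effPot w ω A r ≥ −(1/12 + 104·A)` whenever `0 ≤ w r ≤ 1`, `ω r ≤ 52`, `A ≥ 0`
(`V_LJ ≥ −1/12`). [folklore] -/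
theorem effPot_ge {w ω : ℝ → ℝ} {A r : ℝ} (hA : 0 ≤ A) (hw : 0 ≤ w r ∧ w r ≤ 1) (hω : ω r ≤ 52) :
    -(1 / 12 + 104 * A) ≤ effPot w ω A r := by
  have hV := neg_one_div_le_lennardJones r
  have hcore : -(1 / 12 : ℝ) ≤ lennardJones r * (1 - w r) := by
    rcases le_or_gt 0 (lennardJones r) with hpos | hneg
    · have : 0 ≤ lennardJones r * (1 - w r) := mul_nonneg hpos (by linarith [hw.2])
      linarith
    · have : lennardJones r ≤ lennardJones r * (1 - w r) := by nlinarith [hw.1, hw.2]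
      linarith
  show -(1 / 12 + 104 * A) ≤ lennardJones r * (1 - w r) - 2 * A * ω r
  nlinarith

/-- Packing constant: a `ρ`-ball holds at most `Mball ρ = (20ρ/7 + 1)³` sites (`card_ball_le`). -/
def Mball (ρ : ℝ) : ℝ := (2 * ρ / (7 / 10) + 1) ^ 3

/-- `one_le_Mball` (formal bookkeeping). [folklore] -/
theorem one_le_Mball {ρ : ℝ} (hρ : 0 ≤ ρ) : 1 ≤ Mball ρ := by
  unfold Mball
  have : (1 : ℝ) ≤ 2 * ρ / (7 / 10) + 1 := by
    have : 0 ≤ 2 * ρ / (7 / 10) := by positivity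
    linarith
  exact one_le_pow₀ this

/-- **Site-energy floor** of an admissible instance: `½·Σ_{k≠j} W(r_jk) ≥ −B·Mball R/2` under the hard core. [folklore] -/
theorem siteEnergy_ge {W : ℝ → ℝ} {R B : ℝ} (hW : CutBounds W R B) {N : ℕ} {y : Fin N → E3} (hs : Sep y) (j : Fin N) :
    -(B * Mball R / 2) ≤ siteEnergy W y j / 2 := by
  have hR := hW.range_nonneg
  have hB := hW.floor_nonneg
  have hterm : ∀ k : Fin N, -B * (if dist (y k) (y j) ≤ R then (1 : ℝ) else 0) ≤ W (dist (y j) (y k)) := by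
    intro k
    split_ifs with h5
    · simpa using hW.floor _ (dist_nonneg : 0 ≤ dist (y j) (y k))
    · push Not at h5
      rw [dist_comm] at h5
      rw [hW.vanish _ h5]; simp
  have h1 : ∑ k ∈ Finset.univ.erase j, -B * (if dist (y k) (y j) ≤ R then (1 : ℝ) else 0) ≤ siteEnergy W y j :=
    Finset.sum_le_sum fun k _ => hterm k
  have h2 : ∑ k, -B * (if dist (y k) (y j) ≤ R then (1 : ℝ) else 0)
      ≤ ∑ k ∈ Finset.univ.erase j, -B * (if dist (y k) (y j) ≤ R then (1 : ℝ) else 0) := by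
    rw [← Finset.add_sum_erase Finset.univ _ (Finset.mem_univ j), dist_self, if_pos hR]
    linarith
  have h3 : ∑ k, -B * (if dist (y k) (y j) ≤ R then (1 : ℝ) else 0) = -B * ((ball R y j).card : ℝ) := by
    rw [← Finset.mul_sum, Finset.sum_boole]
    rfl
  have h4 := card_ball_le hR hs j
  have h5 : B * ((ball R y j).card : ℝ) ≤ B * Mball R := by unfold Mball; exact mul_le_mul_of_nonneg_left h4 hB
  linarith

/-- Surplus floor constant of an instance: `D(R,B,e) := B·Mball R/2 + |e| + 1`. -/
def Dfl (R B e : ℝ) : ℝ := B * Mball R / 2 + |e| + 1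

/-- `Dfl_pos` (formal bookkeeping). [folklore] -/
theorem Dfl_pos {R B e : ℝ} (hR : 0 ≤ R) (hB : 0 ≤ B) : 0 < Dfl R B e := by
  unfold Dfl
  have h1 := one_le_Mball hR
  have h2 := abs_nonneg e
  have h3 : 0 ≤ B * Mball R := mul_nonneg hB (by linarith)
  linarith

/-- The column's surplus at the slots of record `η₀ = 1/20`, `η₁ = 1/8`, `κ_T = 1/100`:
`x_j(C_T) = ½Σ_{k≠j} W(r_jk) − e − (1/100)·𝟙[¬GoodAt(1/8) j] + C_T·𝟙[GoodAt(1/20) j]`. -/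
abbrev xS (W : ℝ → ℝ) (e CT : ℝ) {N : ℕ} (y : Fin N → E3) : Fin N → ℝ := surplus (1 / 20) (1 / 8) W e (1 / 100) CT y

/-- **Surplus floor**: `x_j(C_T) ≥ −D` for `C_T ≥ 0`. [folklore] -/
theorem xS_ge {W : ℝ → ℝ} {R B e CT : ℝ} (hW : CutBounds W R B) (hCT : 0 ≤ CT) {N : ℕ} {y : Fin N → E3} (hs : Sep y) (j : Fin N) :
    -Dfl R B e ≤ xS W e CT y j := by
  have h := siteEnergy_ge hW hs j
  show -Dfl R B e ≤ siteEnergy W y j / 2 - e - 1 / 100 * (1 - (if GoodAt (1 / 8) y j then (1 : ℝ) else 0))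
    + CT * (if GoodAt (1 / 20) y j then (1 : ℝ) else 0)
  unfold Dfl
  have hg1 : 0 ≤ 1 / 100 * (1 - (if GoodAt (1 / 8) y j then (1 : ℝ) else 0)) ∧ 1 / 100 * (1 - (if GoodAt (1 / 8) y j then (1 : ℝ) else 0)) ≤ 1 := by
    split_ifs <;> norm_num
  have hg0 : 0 ≤ CT * (if GoodAt (1 / 20) y j then (1 : ℝ) else 0) := by
    split_ifs <;> nlinarith
  linarith [hg1.1, hg1.2, le_abs_self e]

/-- **Tight surplus**: a tightly good site carries `x_j(C_T) ≥ C_T − D`. [folklore] -/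
theorem xS_ge_of_good {W : ℝ → ℝ} {R B e CT : ℝ} (hW : CutBounds W R B) {N : ℕ} {y : Fin N → E3} (hs : Sep y) {j : Fin N}
    (hg : GoodAt (1 / 20) y j) : CT - Dfl R B e ≤ xS W e CT y j := by
  have h := siteEnergy_ge hW hs j
  show CT - Dfl R B e ≤ siteEnergy W y j / 2 - e - 1 / 100 * (1 - (if GoodAt (1 / 8) y j then (1 : ℝ) else 0))
    + CT * (if GoodAt (1 / 20) y j then (1 : ℝ) else 0)
  rw [if_pos hg]
  unfold Dfl
  have hg1 : 1 / 100 * (1 - (if GoodAt (1 / 8) y j then (1 : ℝ) else 0)) ≤ 1 := by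
    split_ifs <;> norm_num
  linarith [le_abs_self e]

/-- **Averaging lemma**: one large term `f a ≥ L ≥ 0` with mass `m a ≤ M`, all terms `≥ −D`, masses `≥ 1`, at most `M` terms
⟹ the mass-weighted sum is `≥ L/M − M·D`. [folklore] -/
theorem sum_div_ge_of_one_large {ι : Type*} (s : Finset ι) {a : ι} (ha : a ∈ s) (f m : ι → ℝ) {L M D : ℝ}
    (hL : 0 ≤ L) (hD : 0 ≤ D) (hm1 : ∀ j ∈ s, 1 ≤ m j) (hma : m a ≤ M) (hcard : (s.card : ℝ) ≤ M)
    (hf : ∀ j ∈ s, -D ≤ f j) (hfa : L ≤ f a) : L / M - M * D ≤ ∑ j ∈ s, f j / m j := by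
  have hMa : 1 ≤ M := (hm1 a ha).trans hma
  have hM : 0 < M := by linarith
  rw [← Finset.add_sum_erase s _ ha]
  have h1 : L / M ≤ f a / m a := by
    have hma1 : 1 ≤ m a := hm1 a ha
    calc L / M ≤ L / m a := div_le_div_of_nonneg_left hL (by linarith) hma
      _ ≤ f a / m a := div_le_div_of_nonneg_right hfa (by linarith)
  have h2 : ∀ j ∈ s.erase a, -D ≤ f j / m j := by
    intro j hj
    have hj' := Finset.mem_of_mem_erase hj
    have hmj := hm1 j hj'
    have hmpos : 0 < m j := by linarith
    rw [le_div_iff₀ hmpos]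
    have := hf j hj'
    nlinarith
  have h3 : -(M * D) ≤ ∑ j ∈ s.erase a, f j / m j := by
    have hc : ((s.erase a).card : ℝ) ≤ M := by
      have := Finset.card_erase_le (s := s) (a := a)
      exact le_trans (by exact_mod_cast this) hcard
    calc -(M * D) ≤ -(((s.erase a).card : ℝ) * D) := by nlinarith
      _ = ∑ j ∈ s.erase a, -D := by rw [Finset.sum_const, nsmul_eq_mul]; ring
      _ ≤ ∑ j ∈ s.erase a, f j / m j := Finset.sum_le_sum h2
  linarith

-- (part B ends; §4–§7 continue in `…AveragingCutC`)
end Summit.AtomisticToContinuum.Crystallization.Theorems.FrustratedLawDichotomyAveragingCut
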